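import Summits.QuantumFields.YangMills.Theorems.FradkinShenkerFlowFiniteSusceptibilityWeakCouplingSiblingFunnel
import Summits.QuantumFields.YangMills.Theorems.ConvexGribovBodyStrongCouplingShape

/-!
# Finite gauge-invariant susceptibility at STRONG coupling (the funnel run on a proved input)

Support file for item stmt-QuantumFields-9442 (crux `FradkinShenkerFlow.FiniteSusceptibilityWeakCoupling`, line
`sup-axis-reflection-transfer`). The crux asks for the clause
`∀ A B, ∃ χ, ∀ S, Σ_{x ∈ box 4 S} |Cov_{β,S}(A∘lift, B∘τ_x∘lift)| ≤ χ` at all `β ≥ β₀(G, r)` (open: the infrared half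
of the lattice mass gap). Here the SAME clause is proved on the strong-coupling window `0 ≤ β < β₁(G, r)`: the CLOSED
sibling item `ConvexGribovBody.StrongCouplingShape` (stmt-QuantumFields-8783, Osterwalder–Seiler analyticity on the
torus) gives volume-uniform exponential time clustering there, the landed RP funnel of this line
(`SiblingFunnel.axialMoments_of_clusteringAt`, `SiblingFunnel.susceptibility_of_axialMoments`: odd-torus reflection
positivity, midpoint-mirror Cauchy–Schwarz, `d = 4` shell count) turns it into the `ℓ¹` bound. Together with
`Negative.fsClause`-type results at `β = 0` this brackets the crux: its clause holds on `[0, β₁)` for every compact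
simple `G` and every lattice representation, and is open exactly on the weak-coupling side.
-/

noncomputable section

open MeasureTheory ProbabilityTheory
open scoped BigOperators
open Literature.MathematicalPhysics.QuantumFieldTheory hiding Site ZdEdge
open Literature.MathematicalPhysics.QuantumLattice
open Literature.Probability.LatticeModels hiding configShift configShift_apply

namespace Summit.QuantumFields.YangMills.Theorems.FiniteSusceptibilityWeakCoupling

/-- **Finite susceptibility at strong coupling, uniformly in the volume.** For every compact simple Lie group `G`
and lattice representation `r` there is `β₁ > 0` such that for `0 ≤ β < β₁` every pair of bounded gauge-invariant
local observables `A, B` has `Σ_{x ∈ box 4 S} |Cov_{β,S}(A∘lift, B∘τ_x∘lift)| ≤ χ(A, B, β)` on every torus `(2S+1)⁴`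
(strong-coupling clustering of item 8783 fed through the line's RP funnel; registered on the item as the proved
sub-goal `stub_strongCouplingClause`, signature verbatim). -/
theorem stub_strongCouplingClause : ∀ (G : Type) [Group G] [TopologicalSpace G] [IsTopologicalGroup G] [CompactSpace G] [MeasurableSpace G] [BorelSpace G], Literature.MathematicalPhysics.QuantumFieldTheory.IsCompactSimpleLieGroup G → ∀ (r : Literature.MathematicalPhysics.QuantumFieldTheory.LatticeRep G), ∃ β₁ : ℝ, 0 < β₁ ∧ ∀ β : ℝ, 0 ≤ β → β < β₁ → ∀ A B : Literature.MathematicalPhysics.QuantumFieldTheory.YMSpecies G, ∃ χ : ℝ, ∀ S : ℕ, ∑ x ∈ Literature.Probability.LatticeModels.box 4 S, |ProbabilityTheory.covariance (fun U => A.F (Literature.MathematicalPhysics.QuantumLattice.torusLift (2 * S + 1) U)) (fun U => B.F (Literature.MathematicalPhysics.QuantumLattice.configShift (-x) (Literature.MathematicalPhysics.QuantumLattice.torusLift (2 * S + 1) U))) (Literature.MathematicalPhysics.QuantumFieldTheory.wilsonMeasure (d := 4) (L := 2 * S + 1) r.ρ β)| ≤ χ := by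
  intro G _ _ _ _ _ _ hG r
  obtain ⟨β₁, hβ₁, h⟩ := strongCouplingShape_proof G hG r
  refine ⟨β₁, hβ₁, fun β hβ0 hβ => ?_⟩
  obtain ⟨m, hm, S₁, hAB⟩ := h β hβ0 hβ
  refine SiblingFunnel.susceptibility_of_axialMoments r hβ0
    (SiblingFunnel.axialMoments_of_clusteringAt r β hm fun A B => ?_)
  obtain ⟨C, hC⟩ := hAB A B
  exact ⟨C, S₁, fun S hS n hn => hC S n hS hn⟩

end Summit.QuantumFields.YangMills.Theorems.FiniteSusceptibilityWeakCoupling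

end
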